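import Mathlib
import Summits.ABC.ABC.Statement
import Summits.ABC.ABC.Theorems.SoloBlindOmega3Corners
import Literature.NumberTheory.DiophantineGeometry.AbcWave0MihailescuProofs
import HarnessLib

/-!
# The remaining factorable corners of the first open support (solo-blind seat, session 5)

On the support `{2, p, q}` an abc triple has prime-power summands (`SoloBlindOmegaFree`).  The exponent
patterns that admit a two-term factorisation over `ℤ` are settled by Mihăilescu's theorem plus divisibility by
`3`; `SoloBlindOmega3Corners` did the prime-square corner and `2^l + q^(2i) = r^(2j)`.  Here:

* `sq_add_sq_corner` : `p^(2i) + q^(2j) = 2^n` with `p, q` odd forces `n = 1` (odd squares are `1 mod 8`) — the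
  corner is empty;
* `sq_add_pow_eq_four_pow_corner` : `p^(2i) + q^m = 2^(2k)` (`p, q` odd primes, `i, m ≥ 1`) is exactly `9 + 7 = 16`;
* `four_pow_add_pow_eq_sq_corner` : `2^(2λ) + q^m = r^(2j)` (`q, r` odd primes, `λ, m, j ≥ 1`) is exactly
  `4 + 5 = 9`, `16 + 9 = 25`, `64 + 17 = 81`.

[Mihailescu2004, Theorem 1]
-/

namespace Summit.ABC.ABC.Theorems

open Literature.NumberTheory.DiophantineGeometry

/-- An odd square is `1 mod 8`. -/
private theorem odd_sq_mod_eight {X : ℕ} (hX : Odd X) : X ^ 2 % 8 = 1 := by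
  have h := Nat.odd_iff.mp hX
  have : X % 8 = 1 ∨ X % 8 = 3 ∨ X % 8 = 5 ∨ X % 8 = 7 := by omega
  rw [Nat.pow_mod]
  rcases this with h | h | h | h <;> rw [h]

/-- **Empty corner.** `p^(2i) + q^(2j) = 2^n` with `p, q` odd forces `n = 1`. -/
theorem sq_add_sq_corner {p q i j n : ℕ} (hp : Odd p) (hq : Odd q) (h : p ^ (2 * i) + q ^ (2 * j) = 2 ^ n) :
    n = 1 := by
  rw [mul_comm 2 i, mul_comm 2 j, pow_mul, pow_mul] at h
  have h1 := odd_sq_mod_eight (hp.pow (n := i))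
  have h2 := odd_sq_mod_eight (hq.pow (n := j))
  have h8 : 2 ^ n % 8 = 2 := by omega
  rcases Nat.lt_or_ge n 3 with hn | hn
  · interval_cases n <;> simp_all
  · exfalso
    have : 8 ∣ 2 ^ n := (pow_dvd_pow 2 hn : 2 ^ 3 ∣ 2 ^ n)
    omega

/-- If `A < B`, `(B - A) * (B + A) = q ^ m` with `q` an odd prime not dividing `A`... we only need: the smaller
factor is `1`.  Here in the form used twice below: `q` prime, `q ∤ 2 * A`, `(B - A) * (B + A) = q ^ m`, `A < B`
imply `B - A = 1`. -/
private theorem sub_eq_one_of_mul_eq_prime_pow {A B q m : ℕ} (hq : q.Prime) (hqA : ¬ q ∣ 2 * A) (hAB : A < B)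
    (h : (B - A) * (B + A) = q ^ m) : B - A = 1 := by
  obtain ⟨u, -, hu⟩ := (Nat.dvd_prime_pow hq).mp (Dvd.intro (B + A) h)
  rcases Nat.eq_zero_or_pos u with rfl | hu0
  · simpa using hu
  · exfalso
    have hq1 : q ∣ B - A := by rw [hu]; exact dvd_pow_self q hu0.ne'
    obtain ⟨v, -, hv⟩ := (Nat.dvd_prime_pow hq).mp (Dvd.intro_left (B - A) h)
    have hv0 : 0 < v := by
      rcases Nat.eq_zero_or_pos v with rfl | hv0
      · rw [pow_zero] at hv
        have hA : A = 0 := by omega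
        subst hA
        exact absurd (by simp) hqA
      · exact hv0
    have hq2 : q ∣ B + A := by rw [hv]; exact dvd_pow_self q hv0.ne'
    have : q ∣ (B + A) - (B - A) := Nat.dvd_sub hq2 hq1
    have h2A : (B + A) - (B - A) = 2 * A := by omega
    rw [h2A] at this
    exact hqA this

/-- **The corner `p^(2i) + q^m = 2^(2k)`.** For odd primes `p, q` and `i, m ≥ 1` the only solution is
`9 + 7 = 16`: `(2^k - p^i)(2^k + p^i) = q^m` forces `2^k - p^i = 1`, then `p^i = 2^k - 1` and `q^m = 2^(k+1) - 1`
are proper powers only in Catalan's case (excluded), so `i = m = 1` and `2^k - 1, 2^(k+1) - 1` both prime,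
`k = 2`.  [Mihailescu2004, Theorem 1] -/
theorem sq_add_pow_eq_four_pow_corner {p q i m k : ℕ} (hp : p.Prime) (hq : q.Prime) (hp2 : p ≠ 2) (hq2 : q ≠ 2)
    (hi : 1 ≤ i) (hm : 1 ≤ m) (h : p ^ (2 * i) + q ^ m = 2 ^ (2 * k)) :
    p = 3 ∧ i = 1 ∧ q = 7 ∧ m = 1 ∧ k = 2 := by
  rw [mul_comm 2 i, mul_comm 2 k, pow_mul, pow_mul] at h
  obtain ⟨X, hXdef⟩ : ∃ X, X = p ^ i := ⟨_, rfl⟩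
  obtain ⟨P, hPdef⟩ : ∃ P, P = 2 ^ k := ⟨_, rfl⟩
  rw [← hXdef, ← hPdef] at h
  have hp3 : 3 ≤ p := by have := hp.two_le; omega
  have hq3 : 3 ≤ q := by have := hq.two_le; omega
  have hX3 : 3 ≤ X := by
    rw [hXdef]
    calc 3 ≤ p := hp3
      _ = p ^ 1 := (pow_one p).symm
      _ ≤ p ^ i := Nat.pow_le_pow_right hp.pos hi
  have hqm : 3 ≤ q ^ m := by
    calc 3 ≤ q := hq3
      _ = q ^ 1 := (pow_one q).symm
      _ ≤ q ^ m := Nat.pow_le_pow_right hq.pos hm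
  have hXP : X < P := by
    have : X ^ 2 < P ^ 2 := by omega
    exact (Nat.pow_lt_pow_iff_left (by norm_num)).mp this
  have hfac : (P - X) * (P + X) = q ^ m := by
    zify [hXP.le]
    have h' : ((X:ℤ) ^ 2 + (q:ℤ) ^ m = (P:ℤ) ^ 2) := by exact_mod_cast h
    linear_combination -h'
  have hqX : ¬ q ∣ 2 * X := by
    intro hdvd
    rcases (Nat.Prime.dvd_mul hq).mp hdvd with h2 | hX
    · have := (Nat.prime_dvd_prime_iff_eq hq Nat.prime_two).mp h2; omega
    · rw [hXdef] at hX
      have := (Nat.prime_dvd_prime_iff_eq hq hp).mp (hq.dvd_of_dvd_pow hX)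
      -- then `q = p` divides `P ^ 2 = X ^ 2 + q ^ m`, so `p ∣ 2 ^ k`, impossible
      subst this
      have hqX' : q ∣ X := by rw [hXdef]; exact dvd_pow_self q (by omega)
      have hqP : q ∣ P ^ 2 := by
        rw [← h]; exact Dvd.dvd.add (dvd_pow hqX' two_ne_zero) (dvd_pow_self q (by omega))
      have := hq.dvd_of_dvd_pow hqP
      rw [hPdef] at this
      have := (Nat.prime_dvd_prime_iff_eq hq Nat.prime_two).mp (hq.dvd_of_dvd_pow this)
      omega
  have h1 : P - X = 1 := sub_eq_one_of_mul_eq_prime_pow hq hqX hXP hfac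
  -- `P = 2^k ≥ 4`, `X = 2^k - 1`, `q^m = 2^(k+1) - 1`
  have hk2 : 2 ≤ k := by
    have : 2 ^ 2 ≤ 2 ^ k := by rw [← hPdef]; omega
    exact (Nat.pow_le_pow_iff_right (by norm_num)).mp this
  have hXk : X + 1 = 2 ^ k := by omega
  have hqmk : q ^ m + 1 = 2 ^ (k + 1) := by rw [pow_succ]; nlinarith [hfac, h1]
  -- `i = 1`
  have hi1 : i = 1 := by
    by_contra hne
    have hcat : 2 ^ k = p ^ i + 1 := by rw [← hXdef]; omega
    have := (mihailescu_holds hp.pos hk2 (by omega) hcat).1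
    omega
  subst hi1
  rw [pow_one] at hXdef
  subst hXdef
  -- `m = 1`
  have hm1 : m = 1 := by
    by_contra hne
    have := (mihailescu_holds hq.pos (by omega : 2 ≤ k + 1) (by omega : 2 ≤ m) hqmk.symm).1
    omega
  subst hm1
  rw [pow_one] at hqmk hfac
  have hk := eq_two_of_prime_two_pow_pred hp hq hXk hqmk
  subst hk
  norm_num at hXk hqmk
  exact ⟨by omega, rfl, by omega, rfl, rfl⟩

/-- **The corner `2^(2λ) + q^m = r^(2j)`.** For odd primes `q, r` and `λ, m, j ≥ 1` the solutions are exactly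
`4 + 5 = 9`, `16 + 9 = 25`, `64 + 17 = 81`: `(r^j - 2^λ)(r^j + 2^λ) = q^m` forces `r^j = 2^λ + 1` (Catalan:
`j = 1`, or `r^j = 9`), and then `q^m = 2^(λ+1) + 1`.  [Mihailescu2004, Theorem 1] -/
theorem four_pow_add_pow_eq_sq_corner {lam q m r j : ℕ} (hq : q.Prime) (hr : r.Prime) (hq2 : q ≠ 2) (hr2 : r ≠ 2)
    (hl : 1 ≤ lam) (hm : 1 ≤ m) (hj : 1 ≤ j) (h : 2 ^ (2 * lam) + q ^ m = r ^ (2 * j)) :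
    (lam = 1 ∧ q = 5 ∧ m = 1 ∧ r = 3 ∧ j = 1) ∨ (lam = 2 ∧ q = 3 ∧ m = 2 ∧ r = 5 ∧ j = 1) ∨
      (lam = 3 ∧ q = 17 ∧ m = 1 ∧ r = 3 ∧ j = 2) := by
  rw [mul_comm 2 lam, mul_comm 2 j, pow_mul, pow_mul] at h
  obtain ⟨X, hXdef⟩ : ∃ X, X = r ^ j := ⟨_, rfl⟩
  obtain ⟨P, hPdef⟩ : ∃ P, P = 2 ^ lam := ⟨_, rfl⟩
  rw [← hXdef, ← hPdef] at h
  have hq3 : 3 ≤ q := by have := hq.two_le; omega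
  have hr3 : 3 ≤ r := by have := hr.two_le; omega
  have hqm : 3 ≤ q ^ m := by
    calc 3 ≤ q := hq3
      _ = q ^ 1 := (pow_one q).symm
      _ ≤ q ^ m := Nat.pow_le_pow_right hq.pos hm
  have hP2 : 2 ≤ P := by
    rw [hPdef]
    calc 2 = 2 ^ 1 := (pow_one 2).symm
      _ ≤ 2 ^ lam := Nat.pow_le_pow_right two_pos hl
  have hPX : P < X := by
    have : P ^ 2 < X ^ 2 := by omega
    exact (Nat.pow_lt_pow_iff_left (by norm_num)).mp this
  have hfac : (X - P) * (X + P) = q ^ m := by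
    zify [hPX.le]
    have h' : ((P:ℤ) ^ 2 + (q:ℤ) ^ m = (X:ℤ) ^ 2) := by exact_mod_cast h
    linear_combination -h'
  have hqP : ¬ q ∣ 2 * P := by
    intro hdvd
    have h2P : 2 * P = 2 ^ (lam + 1) := by rw [hPdef, pow_succ]; ring
    rw [h2P] at hdvd
    have := (Nat.prime_dvd_prime_iff_eq hq Nat.prime_two).mp (hq.dvd_of_dvd_pow hdvd)
    omega
  have h1 : X - P = 1 := sub_eq_one_of_mul_eq_prime_pow hq hqP hPX hfac
  have hXl : X = 2 ^ lam + 1 := by omega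
  have hqml : q ^ m = 2 ^ (lam + 1) + 1 := by rw [pow_succ]; nlinarith [hfac, h1]
  rcases Nat.lt_or_ge j 2 with hj2 | hj2
  · -- `j = 1`: `r = 2^λ + 1`
    have hj1 : j = 1 := by omega
    subst hj1
    rw [pow_one] at hXdef
    subst hXdef
    rcases Nat.lt_or_ge m 2 with hm2 | hm2
    · -- `m = 1`: `q = 2^(λ+1) + 1`, `r = 2^λ + 1` both prime ⟹ `λ = 1`
      have hm1 : m = 1 := by omega
      subst hm1
      rw [pow_one] at hqml
      have := eq_one_of_prime_two_pow_succ hl (hXl ▸ hr) (hqml ▸ hq)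
      subst this
      norm_num at hXl hqml
      left
      exact ⟨rfl, hqml, rfl, hXl, rfl⟩
    · -- `m ≥ 2`: `q^m = 2^(λ+1) + 1` ⟹ `q = 3, m = 2, λ = 2`
      obtain ⟨hq3', hm2', -, hl3⟩ := mihailescu_holds two_pos hm2 (by omega : 2 ≤ lam + 1) hqml
      have hl2 : lam = 2 := by omega
      subst hl2
      norm_num at hXl
      right; left
      exact ⟨rfl, hq3', hm2', hXl, rfl⟩
  · -- `j ≥ 2`: `r^j = 2^λ + 1` ⟹ `r = 3, j = 2, λ = 3`, then `q^m = 17`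
    have hl2 : 2 ≤ lam := by
      by_contra hlt
      have hl1 : lam = 1 := by omega
      subst hl1
      -- `r^j = 3` with `j ≥ 2` impossible
      have : r ^ j = 3 := by rw [← hXdef]; omega
      have h9 : 3 ^ 2 ≤ r ^ j :=
        calc 3 ^ 2 ≤ r ^ 2 := Nat.pow_le_pow_left hr3 2
          _ ≤ r ^ j := Nat.pow_le_pow_right hr.pos hj2
      omega
    obtain ⟨hr3', hj2', -, hl3⟩ := mihailescu_holds two_pos hj2 hl2 (hXdef ▸ hXl)
    subst hl3
    norm_num at hqml
    -- `q^m = 17`, prime, so `m = 1`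
    have hm1 : m = 1 := by
      by_contra hne
      have h2m : 2 ≤ m := by omega
      have : q ^ 2 ≤ q ^ m := Nat.pow_le_pow_right hq.pos h2m
      have : 3 ^ 2 ≤ q ^ 2 := Nat.pow_le_pow_left hq3 2
      -- `q^m = 17 ≥ q^2 ≥ 9` and `q ∣ 17` gives `q = 17`, then `17^2 ≤ 17`, absurd
      have hq17 : q ∣ 17 := by rw [← hqml]; exact dvd_pow_self q (by omega)
      have := (Nat.prime_dvd_prime_iff_eq hq (by norm_num)).mp hq17
      subst this
      omega
    subst hm1
    rw [pow_one] at hqml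
    right; right
    exact ⟨rfl, hqml, rfl, hr3', hj2'⟩

end Summit.ABC.ABC.Theorems
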